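import Summits.AnomalousDissipation.AnomalousDissipation.Theorems.ScalarAnomalySteadySourceFormal.Negative.DriftState

/-!
# Negative knowledge for the crux `ScalarAnomalySteadySourceFormal` (stmt-AnomalousDissipation-0448), VI-b: constant-drift witnesses — exact modal decay and honest multi-mode variance floors

Certified copy of §8 (part 2): the fluctuation `θ - θ_p` of a constant-drift witness (linearity), its uniform `L²` bound, EXACT modal decay at the complex rate `a_k`, slices, and the multi-mode variance floor `∑_{k∈F}‖𝓕θ_p(k)‖²/8 ≤ ⟨‖θ‖²⟩`.
Supports stmt-AnomalousDissipation-0448.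
-/

set_option linter.dupNamespace false

noncomputable section

open scoped BigOperators Topology ENNReal NNReal InnerProductSpace ContDiff
open MeasureTheory Set Filter Function UnitAddTorus Complex

namespace Summit.AnomalousDissipation.AnomalousDissipation.Theorems.ScalarAnomalySteadySourceFormal.Negative

open Literature.Analysis
open Literature.Analysis.FunctionSpaces Literature.Analysis.FunctionSpaces.Torus
open Literature.Analysis.FluidPDE Literature.Analysis.FluidPDE.Torus

variable {d : Type*} [Fintype d] [DecidableEq d]
/-! ### Rest-flow machinery generalised to a constant drift `c` -/

section DriftCore

variable {ν : ℝ} {c : EuclideanSpace ℝ d} {h θ₀ : UnitAddTorus d → ℝ} {θ : ℝ → UnitAddTorus d → ℝ}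

/-- The fluctuation `θ - θ_p` of a constant-drift witness is a homogeneous weak solution. [folklore] -/
theorem dtilde_isWeak (hν : 0 < ν) (hh : IsSmooth h) (hmean : HasZeroMean h) (hθ₀ : MemLp θ₀ 2 volume)
    (hweak : IsWeakScalarTransportForced ν (fun (_ : ℝ) (_ : UnitAddTorus d) => c) (fun _ => h) θ₀ θ)
    {T : ℝ} (hT : 0 < T) :
    IsWeakScalarTransportOn T ν (fun (_ : ℝ) (_ : UnitAddTorus d) => c)
      (fun x => θ₀ x - driftState ν c h x) (fun t x => θ t x - driftState ν c h x) :=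
  forced_sub (hweak T hT) (driftState_isWeak hν c hh hmean T hT) (hθ₀.integrable one_le_two)
    (isSmooth_driftState hν c hh).integrable

omit [DecidableEq d] in
/-- Constant velocity fields are bounded (`L^∞` on every strip). [folklore] -/
theorem memLp_top_constField (cv : EuclideanSpace ℝ d) (T : ℝ) :
    MemLp (FunctionSpaces.Torus.stLift fun (_ : ℝ) (_ : UnitAddTorus d) => cv) ∞
      (volume.restrict (Ioo 0 T ×ˢ univ)) := memLp_top_const _

/-- Uniform `L²` bound on the fluctuation (tree energy inequality, bounded velocity). [folklore] -/
theorem dtilde_ae_lintegral_sq_le (hν : 0 < ν) (hh : IsSmooth h) (hmean : HasZeroMean h)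
    (hθ₀ : MemLp θ₀ 2 volume)
    (hweak : IsWeakScalarTransportForced ν (fun (_ : ℝ) (_ : UnitAddTorus d) => c) (fun _ => h) θ₀ θ)
    {T : ℝ} (hT : 0 < T) :
    ∀ᵐ t ∂(volume.restrict (Ioo 0 T)),
      ∫⁻ x, ‖θ t x - driftState ν c h x‖ₑ ^ 2 ≤ ∫⁻ x, ‖θ₀ x - driftState ν c h x‖ₑ ^ 2 := by
  have hdat : MemLp (fun x => θ₀ x - driftState ν c h x) 2 volume :=
    hθ₀.sub ((isSmooth_driftState hν c hh).memLp 2)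
  filter_upwards [IsWeakScalarTransportOn.lintegral_sq_add_le_holds hν (dtilde_isWeak hν hh hmean hθ₀ hweak hT) hdat
    (memLp_top_constField c T)] with t ht
  exact le_of_add_le_left ht

omit [DecidableEq d] in
/-- Fourier coefficients of `θ · r` for a real constant `r`. [folklore] -/
theorem mFourierCoeff_mul_const (f : UnitAddTorus d → ℝ) (r : ℝ) (k : d → ℤ) :
    mFourierCoeff (fun x => ((f x * r : ℝ) : ℂ)) k = (r : ℂ) * mFourierCoeff (fun x => (f x : ℂ)) k := by
  have e : (fun x => ((f x * r : ℝ) : ℂ)) = fun x => r • (f x : ℂ) := by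
    funext x; rw [Complex.real_smul]; push_cast; ring
  rw [e, mFourierCoeff_real_smul]

/-- **Modes of the fluctuation decay exactly** at the complex rate `a_k`:
`𝓕θ̃(t)(k) = e^{-a_k t} 𝓕(θ₀ - θ_p)(k)` for a.e. `t ∈ (0,T)`. [folklore] -/
theorem dtilde_mode_eq (hν : 0 < ν) (hh : IsSmooth h) (hmean : HasZeroMean h) (hθ₀ : MemLp θ₀ 2 volume)
    (hweak : IsWeakScalarTransportForced ν (fun (_ : ℝ) (_ : UnitAddTorus d) => c) (fun _ => h) θ₀ θ)
    {T : ℝ} (hT : 0 < T) (k : d → ℤ) :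
    ∀ᵐ t ∂(volume.restrict (Ioo 0 T)),
      mFourierCoeff (fun x => ((θ t x - driftState ν c h x : ℝ) : ℂ)) k =
        Complex.exp (-(driftSymbol ν c k) * t) *
          mFourierCoeff (fun x => ((θ₀ x - driftState ν c h x : ℝ) : ℂ)) k := by
  have hW := dtilde_isWeak hν hh hmean hθ₀ hweak hT
  have hdat : Integrable (fun x => θ₀ x - driftState ν c h x) volume :=
    (hθ₀.integrable one_le_two).sub (isSmooth_driftState hν c hh).integrable
  have hmode := hW.ae_mFourierCoeff_eq hdat k
  have hz := hW.integrableOn_mFourierCoeff k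
  refine ae_eq_exp_of_volterra (z₀ := mFourierCoeff (fun x => ((θ₀ x - driftState ν c h x : ℝ) : ℂ)) k)
    (a := driftSymbol ν c k) hz ?_
  filter_upwards [hmode] with t ht
  rw [ht]
  congr 1
  refine integral_congr_ae (Eventually.of_forall fun s => ?_)
  simp only
  simp_rw [mFourierCoeff_mul_const]
  set Z := mFourierCoeff (fun x => ((θ s x - driftState ν c h x : ℝ) : ℂ)) k with hZ
  have e : ∑ j, 2 * Real.pi * I * (k j : ℂ) * ((c j : ℂ) * Z) = 2 * Real.pi * I * (∑ j, (k j : ℂ) * (c j : ℂ)) * Z := by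
    rw [Finset.mul_sum, Finset.sum_mul]
    exact Finset.sum_congr rfl fun j _ => by ring
  have e2 : ((∑ i, (k i : ℝ) * c i : ℝ) : ℂ) = ∑ i, (k i : ℂ) * (c i : ℂ) := by push_cast; rfl
  rw [e, driftSymbol, e2]
  ring

omit [DecidableEq d] in
/-- `‖e^{-a_k t}‖ = e^{-4π²ν|k|² t}`. [folklore] -/
theorem norm_cexp_neg_driftSymbol (ν : ℝ) (c : EuclideanSpace ℝ d) (k : d → ℤ) (t : ℝ) :
    ‖Complex.exp (-(driftSymbol ν c k) * t)‖ = Real.exp (-(4 * Real.pi ^ 2 * ν * freqNormSq k) * t) := by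
  rw [Complex.norm_exp]
  congr 1
  have : (-(driftSymbol ν c k) * (t : ℂ)).re = -((driftSymbol ν c k).re) * t := by
    simp [Complex.mul_re]
  rw [this, re_driftSymbol]

/-- Slices of a constant-drift witness: `L²`, and `𝓕θ(t)(k) = 𝓕θ̃(t)(k) + 𝓕θ_p(k)`. [folklore] -/
theorem d_ae_slice (hν : 0 < ν) (hh : IsSmooth h)
    (hweak : IsWeakScalarTransportForced ν (fun (_ : ℝ) (_ : UnitAddTorus d) => c) (fun _ => h) θ₀ θ)
    {T : ℝ} (hT : 0 < T) (k : d → ℤ) :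
    ∀ᵐ t ∂(volume.restrict (Ioo 0 T)), MemLp (θ t) 2 volume ∧
      MemLp (fun x => θ t x - driftState ν c h x) 2 volume ∧
      mFourierCoeff (fun x => (θ t x : ℂ)) k =
        mFourierCoeff (fun x => ((θ t x - driftState ν c h x : ℝ) : ℂ)) k +
          mFourierCoeff (fun x => (driftState ν c h x : ℂ)) k := by
  have hθp : IsSmooth (driftState ν c h) := isSmooth_driftState hν c hh
  filter_upwards [forced_ae_memLp_two (hweak T hT)] with t ht
  have ht' : MemLp (fun x => θ t x - driftState ν c h x) 2 volume := ht.sub (hθp.memLp 2)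
  refine ⟨ht, ht', ?_⟩
  have e : (fun x => (θ t x : ℂ)) = (fun x => ((θ t x - driftState ν c h x : ℝ) : ℂ)) +
      fun x => (driftState ν c h x : ℂ) := by
    funext x; simp
  rw [e, mFourierCoeff_add]
  · exact (ht'.integrable one_le_two).ofReal
  · exact hθp.integrable.ofReal

/-- Honest variance, upper bound, for a constant-drift witness. [folklore] -/
theorem d_ae_scalarL2Sq_le (hν : 0 < ν) (hh : IsSmooth h) (hmean : HasZeroMean h) (hθ₀ : MemLp θ₀ 2 volume)
    (hweak : IsWeakScalarTransportForced ν (fun (_ : ℝ) (_ : UnitAddTorus d) => c) (fun _ => h) θ₀ θ)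
    {T : ℝ} (hT : 0 < T) :
    ∀ᵐ t ∂(volume.restrict (Ioo 0 T)), scalarL2Sq (θ t) ≤
      2 * (∫⁻ x, ‖θ₀ x - driftState ν c h x‖ₑ ^ 2).toReal + 2 * ∫ x, driftState ν c h x ^ 2 := by
  have hθp : IsSmooth (driftState ν c h) := isSmooth_driftState hν c hh
  have hB : ∫⁻ x, ‖θ₀ x - driftState ν c h x‖ₑ ^ 2 < ⊤ := by
    have hB' := lintegral_rpow_enorm_lt_top_of_eLpNorm_lt_top two_ne_zero ENNReal.ofNat_ne_top
      (hθ₀.sub (hθp.memLp 2)).eLpNorm_lt_top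
    convert hB' using 1
    refine lintegral_congr fun x => ?_
    rw [ENNReal.toReal_ofNat, ENNReal.rpow_two]
    rfl
  filter_upwards [d_ae_slice hν hh hweak hT 0, dtilde_ae_lintegral_sq_le hν hh hmean hθ₀ hweak hT]
    with t ⟨ht, ht', _⟩ hlin
  have e1 : ∫ x, (θ t x - driftState ν c h x) ^ 2 ≤ (∫⁻ x, ‖θ₀ x - driftState ν c h x‖ₑ ^ 2).toReal := by
    rw [integral_sq_eq_toReal_lintegral ht']
    exact ENNReal.toReal_mono hB.ne hlin
  have hpt : ∀ x, θ t x ^ 2 ≤ 2 * (θ t x - driftState ν c h x) ^ 2 + 2 * driftState ν c h x ^ 2 :=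
    fun x => by nlinarith [sq_nonneg (θ t x - 2 * driftState ν c h x)]
  have i1 : Integrable (fun x => 2 * (θ t x - driftState ν c h x) ^ 2) volume := ht'.integrable_sq.const_mul 2
  have i2 : Integrable (fun x => 2 * driftState ν c h x ^ 2) volume := ((hθp.memLp 2).integrable_sq).const_mul 2
  calc scalarL2Sq (θ t) = ∫ x, θ t x ^ 2 := rfl
    _ ≤ ∫ x, (2 * (θ t x - driftState ν c h x) ^ 2 + 2 * driftState ν c h x ^ 2) :=
        integral_mono ht.integrable_sq (i1.add i2) hpt
    _ = (2 * ∫ x, (θ t x - driftState ν c h x) ^ 2) + 2 * ∫ x, driftState ν c h x ^ 2 := by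
        rw [integral_add i1 i2, integral_const_mul, integral_const_mul]
    _ ≤ 2 * (∫⁻ x, ‖θ₀ x - driftState ν c h x‖ₑ ^ 2).toReal + 2 * ∫ x, driftState ν c h x ^ 2 := by
        linarith

omit [DecidableEq d] in
/-- **Finite-mode Bessel**: `∑_{k∈F} ‖𝓕θ(k)‖² ≤ ∫ θ²` for `θ ∈ L²`. [folklore] -/
theorem sum_sq_norm_mFourierCoeff_le_integral_sq {f : UnitAddTorus d → ℝ} (hf : MemLp f 2 volume)
    (F : Finset (d → ℤ)) : ∑ k ∈ F, ‖mFourierCoeff (fun x => (f x : ℂ)) k‖ ^ 2 ≤ ∫ x, f x ^ 2 :=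
  sum_le_hasSum F (fun _ _ => sq_nonneg _) (FunctionSpaces.Torus.hasSum_sq_norm_mFourierCoeff_ofReal hf)

/-- **Honest variance, multi-mode lower bound far out in time** for a constant-drift witness: if
for every `k ∈ F` the fluctuation mode has decayed below half the steady mode from `t₁` on, then
`∑_{k∈F} ‖𝓕θ_p(k)‖²/4 ≤ ‖θ(t)‖²` for a.e. `t ∈ (0,T)`, `t ≥ t₁`. [folklore] -/
theorem d_ae_floor (hν : 0 < ν) (hh : IsSmooth h) (hmean : HasZeroMean h) (hθ₀ : MemLp θ₀ 2 volume)
    (hweak : IsWeakScalarTransportForced ν (fun (_ : ℝ) (_ : UnitAddTorus d) => c) (fun _ => h) θ₀ θ)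
    {T : ℝ} (hT : 0 < T) (F : Finset (d → ℤ)) {t₁ : ℝ}
    (ht₁ : ∀ k ∈ F, mFourierCoeff (fun x => (driftState ν c h x : ℂ)) k ≠ 0 → ∀ t, t₁ ≤ t →
      ‖mFourierCoeff (fun x => ((θ₀ x - driftState ν c h x : ℝ) : ℂ)) k‖ *
      Real.exp (-(4 * Real.pi ^ 2 * ν * freqNormSq k) * t) ≤
        ‖mFourierCoeff (fun x => (driftState ν c h x : ℂ)) k‖ / 2) :
    ∀ᵐ t ∂(volume.restrict (Ioo 0 T)), t₁ ≤ t →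
      (∑ k ∈ F, ‖mFourierCoeff (fun x => (driftState ν c h x : ℂ)) k‖ ^ 2) / 4 ≤ scalarL2Sq (θ t) := by
  have hall_slice : ∀ᵐ t ∂(volume.restrict (Ioo 0 T)), ∀ k ∈ F, mFourierCoeff (fun x => (θ t x : ℂ)) k =
      mFourierCoeff (fun x => ((θ t x - driftState ν c h x : ℝ) : ℂ)) k +
        mFourierCoeff (fun x => (driftState ν c h x : ℂ)) k :=
    (F.eventually_all).2 fun k _ => (d_ae_slice hν hh hweak hT k).mono fun t ht => ht.2.2
  have hall_mode : ∀ᵐ t ∂(volume.restrict (Ioo 0 T)), ∀ k ∈ F,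
      mFourierCoeff (fun x => ((θ t x - driftState ν c h x : ℝ) : ℂ)) k =
        Complex.exp (-(driftSymbol ν c k) * t) * mFourierCoeff (fun x => ((θ₀ x - driftState ν c h x : ℝ) : ℂ)) k :=
    (F.eventually_all).2 fun k _ => dtilde_mode_eq hν hh hmean hθ₀ hweak hT k
  filter_upwards [d_ae_slice hν hh hweak hT 0, hall_slice, hall_mode] with t ⟨ht, _, _⟩ hsl hmo htt
  have hB := sum_sq_norm_mFourierCoeff_le_integral_sq ht F
  have hterm : ∀ k ∈ F, ‖mFourierCoeff (fun x => (driftState ν c h x : ℂ)) k‖ ^ 2 / 4 ≤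
      ‖mFourierCoeff (fun x => (θ t x : ℂ)) k‖ ^ 2 := by
    intro k hk
    set P := mFourierCoeff (fun x => (driftState ν c h x : ℂ)) k with hP
    set z₀ := mFourierCoeff (fun x => ((θ₀ x - driftState ν c h x : ℝ) : ℂ)) k with hz₀
    by_cases hP0 : P = 0
    · rw [hP0, norm_zero]; norm_num
    rw [hsl k hk, hmo k hk]
    have hz : ‖Complex.exp (-(driftSymbol ν c k) * t) * z₀‖ ≤ ‖P‖ / 2 := by
      rw [norm_mul, norm_cexp_neg_driftSymbol, mul_comm]
      exact ht₁ k hk hP0 t htt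
    have htri : ‖P‖ - ‖P‖ / 2 ≤ ‖Complex.exp (-(driftSymbol ν c k) * t) * z₀ + P‖ := by
      have := norm_sub_norm_le P (-(Complex.exp (-(driftSymbol ν c k) * t) * z₀))
      rw [norm_neg, sub_neg_eq_add, add_comm] at this
      linarith
    have hP2 : ‖P‖ / 2 ≤ ‖Complex.exp (-(driftSymbol ν c k) * t) * z₀ + P‖ := by linarith
    have hsq := pow_le_pow_left₀ (by positivity) hP2 2
    calc ‖P‖ ^ 2 / 4 = (‖P‖ / 2) ^ 2 := by ring
      _ ≤ _ := hsq
  calc (∑ k ∈ F, ‖mFourierCoeff (fun x => (driftState ν c h x : ℂ)) k‖ ^ 2) / 4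
      = ∑ k ∈ F, ‖mFourierCoeff (fun x => (driftState ν c h x : ℂ)) k‖ ^ 2 / 4 := by
        rw [Finset.sum_div]
    _ ≤ ∑ k ∈ F, ‖mFourierCoeff (fun x => (θ t x : ℂ)) k‖ ^ 2 := Finset.sum_le_sum hterm
    _ ≤ ∫ x, θ t x ^ 2 := hB
    _ = scalarL2Sq (θ t) := rfl

/-- **MULTI-MODE VARIANCE FLOOR** for a constant-drift witness: for every finite set of modes,
`∑_{k∈F} ‖𝓕θ_p(k)‖²/8 ≤ ⟨‖θ‖²⟩`, the long-time average being honest. [folklore] -/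
theorem d_variance_floor (hν : 0 < ν) (hh : IsSmooth h) (hmean : HasZeroMean h) (hθ₀ : MemLp θ₀ 2 volume)
    (hweak : IsWeakScalarTransportForced ν (fun (_ : ℝ) (_ : UnitAddTorus d) => c) (fun _ => h) θ₀ θ)
    (F : Finset (d → ℤ)) (hF : ∀ k ∈ F, k ≠ 0) :
    (∑ k ∈ F, ‖mFourierCoeff (fun x => (driftState ν c h x : ℂ)) k‖ ^ 2) / 8 ≤
      longTimeAvgSup (fun t => scalarL2Sq (θ t)) := by
  set S := ∑ k ∈ F, ‖mFourierCoeff (fun x => (driftState ν c h x : ℂ)) k‖ ^ 2 with hS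
  set M : ℝ := 2 * (∫⁻ x, ‖θ₀ x - driftState ν c h x‖ₑ ^ 2).toReal + 2 * ∫ x, driftState ν c h x ^ 2 with hM
  set g : ℝ → ℝ := fun t => scalarL2Sq (θ t) with hg
  have hg0 : ∀ t, 0 ≤ g t := fun t => scalarL2Sq_nonneg _
  have hS0 : 0 ≤ S := Finset.sum_nonneg fun k _ => sq_nonneg _
  -- decay times, one per mode with nonzero steady coefficient, combined over the finite set
  have hev : ∀ᶠ t : ℝ in atTop, ∀ k ∈ F, mFourierCoeff (fun x => (driftState ν c h x : ℂ)) k ≠ 0 →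
      ‖mFourierCoeff (fun x => ((θ₀ x - driftState ν c h x : ℝ) : ℂ)) k‖ *
        Real.exp (-(4 * Real.pi ^ 2 * ν * freqNormSq k) * t) ≤
          ‖mFourierCoeff (fun x => (driftState ν c h x : ℂ)) k‖ / 2 := by
    refine (F.eventually_all).2 fun k hk => ?_
    set P := mFourierCoeff (fun x => (driftState ν c h x : ℂ)) k
    set z₀ := mFourierCoeff (fun x => ((θ₀ x - driftState ν c h x : ℝ) : ℂ)) k
    set a : ℝ := 4 * Real.pi ^ 2 * ν * freqNormSq k with ha_def
    have ha : 0 < a := by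
      rw [ha_def]
      have := lt_of_lt_of_le one_pos (FunctionSpaces.Torus.one_le_freqNormSq_of_ne_zero (hF k hk))
      positivity
    by_cases hP0 : P = 0
    · exact Eventually.of_forall fun t hne => absurd hP0 hne
    have hP : 0 < ‖P‖ := norm_pos_iff.2 hP0
    have h1 : Tendsto (fun t : ℝ => a * t) atTop atTop := tendsto_id.const_mul_atTop ha
    have h2 : Tendsto (fun t : ℝ => Real.exp (-(a * t))) atTop (nhds 0) :=
      Real.tendsto_exp_neg_atTop_nhds_zero.comp h1
    have h3 : Tendsto (fun t : ℝ => ‖z₀‖ * Real.exp (-a * t)) atTop (nhds (‖z₀‖ * 0)) := by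
      refine (h2.const_mul ‖z₀‖).congr fun t => ?_
      rw [neg_mul]
    rw [mul_zero] at h3
    exact (h3.eventually (Iio_mem_nhds (by positivity : (0 : ℝ) < ‖P‖ / 2))).mono fun t ht _ => ht.le
  obtain ⟨t₀, ht₀⟩ := eventually_atTop.1 hev
  set t₁ : ℝ := max t₀ 0 with ht₁_def
  have ht₁0 : 0 ≤ t₁ := le_max_right _ _
  have ht₁ : ∀ k ∈ F, mFourierCoeff (fun x => (driftState ν c h x : ℂ)) k ≠ 0 → ∀ t, t₁ ≤ t →
      ‖mFourierCoeff (fun x => ((θ₀ x - driftState ν c h x : ℝ) : ℂ)) k‖ *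
        Real.exp (-(4 * Real.pi ^ 2 * ν * freqNormSq k) * t) ≤
          ‖mFourierCoeff (fun x => (driftState ν c h x : ℂ)) k‖ / 2 :=
    fun k hk hne t ht => ht₀ t ((le_max_left _ _).trans ht) k hk hne
  -- Cesàro means: lower and upper bounds
  have hmean_bounds : ∀ T, 2 * t₁ ≤ T → 1 ≤ T → S / 8 ≤ timeMean g T ∧ timeMean g T ≤ M := by
    intro T hT2 hT1
    have hT : 0 < T := by linarith
    have hmeas := aestronglyMeasurable_scalarL2Sq (hweak T hT)
    have hbound := d_ae_scalarL2Sq_le hν hh hmean hθ₀ hweak hT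
    have hint : IntegrableOn g (Ioo 0 T) volume := by
      refine IntegrableOn.of_bound measure_Ioo_lt_top hmeas M ?_
      filter_upwards [hbound] with t ht
      rw [Real.norm_eq_abs, abs_of_nonneg (hg0 t)]
      exact ht
    have htm : timeMean g T = T⁻¹ * ∫ t in Ioo 0 T, g t := by
      rw [timeMean, intervalIntegral.integral_of_le hT.le, integral_Ioc_eq_integral_Ioo]
    constructor
    · have hfloor := d_ae_floor hν hh hmean hθ₀ hweak hT F ht₁
      have hsub : Ioo t₁ T ⊆ Ioo 0 T := Ioo_subset_Ioo_left ht₁0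
      have h1 : ∫ t in Ioo t₁ T, (S / 4 : ℝ) ≤ ∫ t in Ioo t₁ T, g t := by
        refine integral_mono_ae (integrableOn_const (hs := measure_Ioo_lt_top.ne)) (hint.mono_set hsub) ?_
        have hfl' := ae_restrict_of_ae_restrict_of_subset hsub hfloor
        filter_upwards [hfl', ae_restrict_mem measurableSet_Ioo] with t ht htI
        exact ht htI.1.le
      have h2 : ∫ t in Ioo t₁ T, g t ≤ ∫ t in Ioo 0 T, g t :=
        setIntegral_mono_set hint (Eventually.of_forall fun t => hg0 t) (Eventually.of_forall hsub)
      rw [setIntegral_const_Ioo (by linarith) (S / 4)] at h1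
      rw [htm]
      have hTi : 0 < T⁻¹ := inv_pos.2 hT
      have key : T / 2 * (S / 4) ≤ ∫ t in Ioo 0 T, g t := by
        have : T / 2 ≤ T - t₁ := by linarith
        nlinarith
      calc S / 8 = T⁻¹ * (T / 2 * (S / 4)) := by field_simp; ring
        _ ≤ T⁻¹ * ∫ t in Ioo 0 T, g t := mul_le_mul_of_nonneg_left key hTi.le
    · have h1 : ∫ t in Ioo 0 T, g t ≤ ∫ t in Ioo 0 T, (M : ℝ) :=
        integral_mono_ae hint (integrableOn_const (hs := measure_Ioo_lt_top.ne)) hbound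
      rw [setIntegral_const_Ioo hT.le, sub_zero] at h1
      rw [htm]
      calc T⁻¹ * ∫ t in Ioo 0 T, g t ≤ T⁻¹ * (T * M) := mul_le_mul_of_nonneg_left h1 (inv_pos.2 hT).le
        _ = M := by field_simp
  have hfreq : ∃ᶠ T in atTop, S / 8 ≤ timeMean g T := by
    refine Eventually.frequently ?_
    filter_upwards [eventually_ge_atTop (2 * t₁), eventually_ge_atTop (1 : ℝ)] with T h1 h2
    exact (hmean_bounds T h1 h2).1
  have hbdd : IsBoundedUnder (· ≤ ·) atTop (timeMean g) := by
    refine ⟨M, ?_⟩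
    rw [eventually_map]
    filter_upwards [eventually_ge_atTop (2 * t₁), eventually_ge_atTop (1 : ℝ)] with T h1 h2
    exact (hmean_bounds T h1 h2).2
  exact le_limsup_of_frequently_le hfreq hbdd

end DriftCore


end Summit.AnomalousDissipation.AnomalousDissipation.Theorems.ScalarAnomalySteadySourceFormal.Negative
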